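import Summits.QuantumFields.YangMills.Theorems.BalabanUVNodesN18KeyingsModuloN22

/-!
# BalabanUVNodes ∕ N18 — THE KEYINGS COINCIDE MODULO N22, FILE 2: (A) the node-U2 TWIN (β-level: the step-matched ∕ pointwise SCALE SHIFT + a history-Lipschitz law whose
# FIRST-entry modulus fades ⟹ the BOX `ScaleShiftRate`), (B) the N17 conjunct at the pinned bundle from the N19′ `h18` shape + N22 + (D4) (`SpineRates.n17At_of_u3` ∘ FILE 1),
# (C) SHARPNESS — a first-entry-only toy where NE9 holds with a NON-fading first-entry modulus, the step-matched letter holds exactly, and the box letter FAILS: the UV-fading of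
# the first-entry modulus (node N22's row) is exactly what FILE 1's «mod N22» cannot drop — the F-E shadow in miniature (FILE 3 `…RunToy`: the run-window keying is STRICTLY weaker)
# (Track A, DAG node N18 = NE5 → its out-edge to node U2 = N17; key K3⁸ `SpineGivenEndpointR13SepCoPHV` = stmt-QuantumFields-27366, skeleton v6 b4e55110ab73e679; width seat
# `pub-ymgap-dag-n18-w1` g8, FILE 2 — companion of FILE 1 `…N18KeyingsModuloN22`)

HONEST FRAMING.  Count-neutral bookkeeping BY NAME (`--kind proof --supports stmt-QuantumFields-27366 --as helper`): (A) is one triangle inequality in node U2's currency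
(`T4CouplingMatching.ScaleShiftRate ∕ HistLipschitz`); (B) is `SpineRates.n17At_of_u3` applied to FILE 1's pin theorem; (C) is an explicit toy over ABSTRACT carriers (no Bałaban
object).  Every letter (the step-matched ∕ pointwise shift, the history-Lipschitz law and the fading of its first-entry column, predecessor existence, (D4) `ReadOutAt`, `N22At`, the
selector-keyed NE5) is a DISPLAYED HYPOTHESIS, asserted ∕ inhabited nowhere new; nothing of Bałaban's is asserted, inhabited, discharged or refuted; NE4 ∕ NE5 ∕ NE9 NOT PRINTED for
d = 4; N17 ∕ N18 ∕ N22 ∕ (D4) NOT discharged; K3⁸ OPEN (v6), no stub proved ∕ refuted, NO re-keying done or asked; K3⁷ 20544 aside.  Counts UNMOVED (typed 28∕28 · discharged 5∕27,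
A 5∕28).  One finite four-torus programme at fixed `ε`, Bałaban AS PRINTED; route R4 closes ONLY the conditional finite-𝕋⁴ rung `BalabanLadder.UV` — NOT the continuum limit, NOT
ℝ⁴, NOT OS, NOT the Yang–Mills mass gap, NOT Clay.  THEOREMS ONLY: 0 `def`, 0 `instance`, 0 `sorry`, standard axioms.

WHAT (theorems only).  §4 node U2 currency: `sum_moduli_cons_tail` · ★ `scaleShiftRate_of_pointwise_of_histLipschitz_firstEntry` (shift at SOME prepended member per tail +
`HistLipschitz Λ γ β` with `0 ≤ Λ (k+1) 0 ≤ C₉ω^{k+1}`, `0 ≤ ω ≤ θ` ⟹ `ScaleShiftRate (c + C₉ωγ) θ γ β`) · ★ `scaleShiftRate_of_stepMatchedShift_of_histLipschitz_firstEntry` (the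
STEP-MATCHED shift — g7's `ShiftAlongRun` integrand asked at every box history whose head obeys the first (0.20) step — + predecessor existence ⟹ the box shift) ·
`stepMatchedShift_of_scaleShiftRate` · `exists_scaleShiftRate_iff_exists_stepMatchedShift`.  §5 carriers ∕ pin: ★ `n17At_rateCarriers_of_kernels_pin_of_readOutAt_n22At_ne5_selector`
((D4) + N22 + the N19′ `h18` shape at ANY admissible selector ⟹ `N17At D (rateCarriersOfRecord₁₃CoPH 𝔯 …).u3`, the DERIVED conjunct, via FILE 1 + `n17At_of_u3`).  §6 the sharpness toy
(first-entry-only family `EA s X = a·s₀`, `EB b s X = a·b`, the §1 link at the level shift): `toy_link` · `toy_ne9_firstEntryModulus` (NE9 with the CONSTANT first-entry modulus `|a|`) ·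
`toy_firstEntryModulus_not_fading` (`a ≠ 0` ⟹ no `C₉, ω < 1` with `|a| ≤ C₉ω^n`) · `toy_stepMatched_zero` (β ≡ 0: the step-matched letter with constant 0) · `toy_not_boxLetter` (`a ≠ 0`,
`γ > 0`, `θ < 1` ⟹ the box letter fails for every `C₅`).

References (TYPES ∕ locators only): [Balaban1987RG1] CMP **109** (1987): (0.20) p. 256, Thm 1 p. 259, (1.20)–(1.22) p. 264, §5 p. 298.
-/

noncomputable section

namespace YMDAG.N18.KeyingsModuloN22

open scoped BigOperators
open Literature.MathematicalPhysics.QuantumFieldTheory.Balaban1983to89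
open Literature.MathematicalPhysics.QuantumFieldTheory.Balaban1983to89.T4Continuum (T4Family ULoop)
open Literature.MathematicalPhysics.QuantumFieldTheory.Balaban1983to89.FlowStep (Box HBeta mem_box)
open Literature.MathematicalPhysics.QuantumFieldTheory.Balaban1983to89.T4CouplingMatching (ScaleShiftRate HistLipschitz)
open Literature.MathematicalPhysics.QuantumFieldTheory.Balaban1983to89.T4FlagMemory (tail_mem_box)
open Literature.MathematicalPhysics.QuantumFieldTheory.Balaban1983to89.T4OutputRate (Carriers Functional Window NE5 NE9 mem_window)
open Literature.MathematicalPhysics.QuantumFieldTheory.Balaban1983to89.Node00 (prependCoupling prependCoupling_zero U3Letters₁₁ Stage13Params Stage13HParams)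
open Literature.MathematicalPhysics.QuantumFieldTheory.Balaban1983to89.Node00.U3OfKernels (objectsOfRecord₁₃)
open Summit.QuantumFields.BalabanUV.T4Continuum
open Summit.QuantumFields.BalabanUV.T4Continuum.Spine
open YMDAG.UVSplit

/-! ## §4 Node U2 currency: the BOX scale shift from SOME prepended member per tail ∕ from the step-matched shift, modulo a fading FIRST-entry modulus of `β` -/

section Beta

variable {β : HBeta} {Λ : ℕ → ℕ → ℝ} {γ C₉ ω θ c : ℝ}

/-- The history sum of `w` against `Fin.cons b₀ (Fin.tail w)` reads the FIRST-entry modulus only (the two vectors agree from index `1` on). [folklore] -/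
theorem sum_moduli_cons_tail (Λ : ℕ → ℕ → ℝ) (k : ℕ) (w : Fin (k + 2) → ℝ) (b₀ : ℝ) :
    ∑ i : Fin (k + 2), Λ (k + 1) i * |w i - Fin.cons b₀ (Fin.tail w) i| = Λ (k + 1) 0 * |w 0 - b₀| := by
  rw [Fin.sum_univ_succ]
  have hz : ∑ i : Fin (k + 1), Λ (k + 1) (i.succ : Fin (k + 2)) * |w i.succ - Fin.cons b₀ (Fin.tail w) i.succ| = 0 :=
    Finset.sum_eq_zero fun i _ => by simp [Fin.tail]
  rw [hz, add_zero]
  simp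

/-- ★ **THE BOX SCALE SHIFT FROM SOME PREPENDED MEMBER PER TAIL** (node U2 twin of FILE 1's `ne5_family_of_pointwise`): a history-Lipschitz law `HistLipschitz Λ γ β` whose FIRST-entry
column fades (`0 ≤ Λ (k+1) 0 ≤ C₉ω^{k+1}`, `0 ≤ ω ≤ θ`) and, for every tail `v ∈ ]0,γ]^{k+1}`, SOME head `b₀ ∈ ]0,γ]` with `|β_{k+2}(b₀, v) − β_{k+1}(v)| ≤ cθ^k` ⟹ the BOX letter
`ScaleShiftRate (c + C₉ωγ) θ γ β` (node N17's `N17At` shape for `D.βfun`).  One triangle inequality through `(b₀, v)`. [cite: Balaban1987RG1, (1.20)–(1.22) p.264 and §5 p.298] -/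
theorem scaleShiftRate_of_pointwise_of_histLipschitz_firstEntry (hL : HistLipschitz Λ γ β)
    (h0 : ∀ k, 0 ≤ Λ (k + 1) 0 ∧ Λ (k + 1) 0 ≤ C₉ * ω ^ (k + 1)) (hC₉ : 0 ≤ C₉) (hω0 : 0 ≤ ω) (hωθ : ω ≤ θ)
    (h5 : ∀ (k : ℕ) (v : Fin (k + 1) → ℝ), v ∈ Box γ k → ∃ b₀ : ℝ, 0 < b₀ ∧ b₀ ≤ γ ∧ |β (k + 1) (Fin.cons b₀ v) - β k v| ≤ c * θ ^ k) :
    ScaleShiftRate (c + C₉ * ω * γ) θ γ β := by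
  intro k w hw
  have htail : Fin.tail w ∈ Box γ k := tail_mem_box hw
  obtain ⟨b₀, hb₀, hb₀γ, h1⟩ := h5 k (Fin.tail w) htail
  have hw' : Fin.cons b₀ (Fin.tail w) ∈ Box γ (k + 1) :=
    mem_box.mpr fun i => Fin.cases (by simpa using And.intro hb₀ hb₀γ) (fun j => by simpa [Fin.tail] using mem_box.mp hw j.succ) i
  have h2 := hL (k + 1) w (Fin.cons b₀ (Fin.tail w)) hw hw'
  rw [sum_moduli_cons_tail] at h2
  have hw0 : 0 < w 0 ∧ w 0 ≤ γ := mem_box.mp hw 0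
  have hγ : 0 ≤ γ := hw0.1.le.trans hw0.2
  have hbb : |w 0 - b₀| ≤ γ := by
    rw [abs_sub_le_iff]
    constructor <;> linarith
  have hpow : ω ^ k ≤ θ ^ k := pow_le_pow_left₀ hω0 hωθ k
  have h3 : Λ (k + 1) 0 * |w 0 - b₀| ≤ C₉ * ω * γ * θ ^ k :=
    calc Λ (k + 1) 0 * |w 0 - b₀| ≤ C₉ * ω ^ (k + 1) * γ := mul_le_mul (h0 k).2 hbb (abs_nonneg _) (by positivity)
      _ = C₉ * ω * γ * ω ^ k := by ring
      _ ≤ C₉ * ω * γ * θ ^ k := mul_le_mul_of_nonneg_left hpow (by positivity)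
  calc |β (k + 1) w - β k (Fin.tail w)|
      ≤ |β (k + 1) w - β (k + 1) (Fin.cons b₀ (Fin.tail w))| + |β (k + 1) (Fin.cons b₀ (Fin.tail w)) - β k (Fin.tail w)| := abs_sub_le _ _ _
    _ ≤ Λ (k + 1) 0 * |w 0 - b₀| + c * θ ^ k := add_le_add h2 h1
    _ ≤ C₉ * ω * γ * θ ^ k + c * θ ^ k := add_le_add h3 le_rfl
    _ = (c + C₉ * ω * γ) * θ ^ k := by ring

/-- ★ **THE BOX SCALE SHIFT FROM THE STEP-MATCHED SHIFT** — node N17's letter asked ONLY at the box histories `w` whose head obeys the first (0.20) step `1∕(w 0)² = 1∕(w 1)² + β₁(w 0)`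
(the integrand of g7's `ShiftAlongRun` at the prefix window, now at every matched box history) + predecessor existence in `]0,γ]` + the fading first-entry column of `HistLipschitz`
⟹ `ScaleShiftRate (c + C₉ωγ) θ γ β`. [cite: Balaban1987RG1, (0.20) p.256, (1.20)–(1.22) p.264 and §5 p.298] -/
theorem scaleShiftRate_of_stepMatchedShift_of_histLipschitz_firstEntry (hL : HistLipschitz Λ γ β)
    (h0 : ∀ k, 0 ≤ Λ (k + 1) 0 ∧ Λ (k + 1) 0 ≤ C₉ * ω ^ (k + 1)) (hC₉ : 0 ≤ C₉) (hω0 : 0 ≤ ω) (hωθ : ω ≤ θ)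
    (hSM : ∀ (k : ℕ) (w : Fin (k + 2) → ℝ), w ∈ Box γ (k + 1) → 1 / (w 0) ^ 2 = 1 / (Fin.tail w 0) ^ 2 + β 0 (fun _ => w 0) →
      |β (k + 1) w - β k (Fin.tail w)| ≤ c * θ ^ k)
    (hpred : ∀ x, 0 < x → x ≤ γ → ∃ b, 0 < b ∧ b ≤ γ ∧ 1 / b ^ 2 = 1 / x ^ 2 + β 0 (fun _ => b)) :
    ScaleShiftRate (c + C₉ * ω * γ) θ γ β :=
  scaleShiftRate_of_pointwise_of_histLipschitz_firstEntry hL h0 hC₉ hω0 hωθ fun k v hv => by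
    obtain ⟨b, hb, hbγ, hm⟩ := hpred (v 0) (mem_box.mp hv 0).1 (mem_box.mp hv 0).2
    have hw : Fin.cons b v ∈ Box γ (k + 1) :=
      mem_box.mpr fun i => Fin.cases (by simpa using And.intro hb hbγ) (fun j => by simpa using mem_box.mp hv j) i
    refine ⟨b, hb, hbγ, ?_⟩
    have h := hSM k (Fin.cons b v) hw (by simpa using hm)
    simpa using h

/-- The box letter gives the step-matched shift trivially (drop the matching condition) — the converse direction of the equivalence below. [cite: Balaban1987RG1, (1.20)–(1.22) p.264] -/
theorem stepMatchedShift_of_scaleShiftRate (h : ScaleShiftRate c θ γ β) :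
    ∀ (k : ℕ) (w : Fin (k + 2) → ℝ), w ∈ Box γ (k + 1) → 1 / (w 0) ^ 2 = 1 / (Fin.tail w 0) ^ 2 + β 0 (fun _ => w 0) →
      |β (k + 1) w - β k (Fin.tail w)| ≤ c * θ ^ k :=
  fun k w hw _ => h k w hw

/-- **BOX ⟺ STEP-MATCHED FOR NODE N17 MODULO THE FADING FIRST-ENTRY COLUMN** (existential constants) — the node-U2 twin of FILE 1's `exists_kernelStepRate_iff_exists_kernelStepMatched`; at
K3's carriers the β-moduli are `u.cr·u.Λ (k+1) i` with `u.Λ a i = u.C₉·u.ω^(a−i)` (`T4BetaReadOutLipschitz.histLipschitz_of_ne9_on` from (D4) + N22), so the column fades there.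
[cite: Balaban1987RG1, (0.20) p.256, (1.20)–(1.22) p.264 and §5 p.298] -/
theorem exists_scaleShiftRate_iff_exists_stepMatchedShift (hL : HistLipschitz Λ γ β)
    (h0 : ∀ k, 0 ≤ Λ (k + 1) 0 ∧ Λ (k + 1) 0 ≤ C₉ * ω ^ (k + 1)) (hC₉ : 0 ≤ C₉) (hω0 : 0 ≤ ω) (hωθ : ω ≤ θ)
    (hpred : ∀ x, 0 < x → x ≤ γ → ∃ b, 0 < b ∧ b ≤ γ ∧ 1 / b ^ 2 = 1 / x ^ 2 + β 0 (fun _ => b)) :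
    (∃ c : ℝ, ScaleShiftRate c θ γ β) ↔
      ∃ c : ℝ, ∀ (k : ℕ) (w : Fin (k + 2) → ℝ), w ∈ Box γ (k + 1) → 1 / (w 0) ^ 2 = 1 / (Fin.tail w 0) ^ 2 + β 0 (fun _ => w 0) →
        |β (k + 1) w - β k (Fin.tail w)| ≤ c * θ ^ k :=
  ⟨fun ⟨c, h⟩ => ⟨c, stepMatchedShift_of_scaleShiftRate h⟩,
    fun ⟨_, h⟩ => ⟨_, scaleShiftRate_of_stepMatchedShift_of_histLipschitz_firstEntry hL h0 hC₉ hω0 hωθ h hpred⟩⟩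

end Beta

/-! ## §5 At K3's carriers under the pin: the DERIVED N17 conjunct from (D4) + N22 + the N19′ `h18` shape at any admissible selector -/

section Pin

open scoped Matrix.Norms.L2Operator

variable (F : T4Family) {N : ℕ} [NeZero N]

/-- ★ **THE N17 CONJUNCT AT THE PINNED BUNDLE FROM (D4) + N22 + THE N19′ `h18` SHAPE**: under K3's node-U3 pin, `ReadOutAt D R.u3` and `N22At R.u3` (two conjuncts the rates face
`PHolderD4` already carries at `R.u3 = (rateCarriersOfRecord₁₃CoPH 𝔯 F θ hP g₀ os k).u3`), `ℓ.Signs`, `ℓ.ω ≤ ℓ.θ₅`, and the selector-keyed NE5 at ANY admissible selector (constant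
`ℓ.C₅ − ℓ.C₉·θ.γ`) ⟹ `N17At D R.u3` — FILE 1's `n18At_rateCarriers_of_kernels_pin_of_n22At_of_ne5_selector` then `SpineRates.n17At_of_u3`.  So under the pin BOTH of `RatesHolderAt`'s
N17 ∕ N18 conjuncts follow from the N19′ edge's own `h18` shape once (D4) and N22 hold. [cite: Balaban1987RG1, Thm 1 p.259, (1.20)–(1.22) p.264 and §5 p.298] -/
theorem n17At_rateCarriers_of_kernels_pin_of_readOutAt_n22At_ne5_selector (𝔯 : RateReading₁₃CoPH N) (θ : Stage13HParams F N)
    (hP : θ.Provisos₁₃CoPH F N) (g₀ : ℕ → ℝ) (os : List (ULoop F)) (ℓ : U3Letters₁₁)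
    (hpin : (𝔯.lit F θ hP g₀ os).u3 = objectsOfRecord₁₃ F N θ.toStage13Params ℓ) (hs : ℓ.Signs) (hωθ : ℓ.ω ≤ ℓ.θ₅) (k : ℕ) (D : Datum F N)
    (hD4 : ReadOutAt D (rateCarriersOfRecord₁₃CoPH 𝔯 F θ hP g₀ os k).u3) (h22 : N22At (rateCarriersOfRecord₁₃CoPH 𝔯 F θ hP g₀ os k).u3)
    {bsel : (ℕ → ℝ) → ℝ} (hbsel : ∀ g ∈ Window θ.γ, 0 < bsel g ∧ bsel g ≤ θ.γ)
    (h18 : NE5 ((objectsOfRecord₁₃ F N θ.toStage13Params ℓ).EA k) (fun s => (objectsOfRecord₁₃ F N θ.toStage13Params ℓ).EB k (bsel s) s)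
      (Window θ.γ) ℓ.κ ℓ.θ₅ (ℓ.C₅ - ℓ.C₉ * θ.γ)) :
    N17At D (rateCarriersOfRecord₁₃CoPH 𝔯 F θ hP g₀ os k).u3 :=
  n17At_of_u3 D hD4 (n18At_rateCarriers_of_kernels_pin_of_n22At_of_ne5_selector F 𝔯 θ hP g₀ os ℓ hpin hs hωθ k k h22 hbsel h18) h22

end Pin

/-! ## §6 SHARPNESS: a first-entry-only toy — NE9 with a CONSTANT (non-fading) first-entry modulus, the step-matched letter EXACT, the box letter FALSE

Carriers: domains `ℕ` with scale `X ↦ X + 1` and tree length `0`, one-point backgrounds, identity transport.  Run A's functional `EA s X := a·(s 0)` reads the FIRST coupling only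
(the F-E structure in miniature); run B's family `EB b s X := a·b` IS `EA` along the prepended sequence at the shifted level (§1's link).  NE9 holds with the first-entry modulus
`Λ n 0 = |a|` (constant in `n`: NO UV-fading), the step-matched letter for `β ≡ 0` holds with constant `0` (matched pairs have `b = s 0`), and the box letter fails for every
`C₅` and `θ < 1` as soon as `a ≠ 0`: so FILE 1's hypothesis «the first-entry modulus fades» cannot be dropped, and a first-entry-only family kills the box letter EXACTLY through
the non-fading of that modulus (g6 FILE 1's rigidity, read from node N22's side). -/

section Toy

/-- §1's LINK holds in the toy: run B's family is run A's functional along the prepended sequence at the shifted level. [folklore] -/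
theorem toy_link (a : ℝ) :
    let C : Carriers := ⟨ℕ, fun X => X + 1, fun _ => 0, fun _ => le_rfl, PUnit, PUnit, fun _ _ => 0, fun _ _ => le_rfl, id⟩
    let EA : Functional C C.BgA := fun s _ _ => a * s 0
    let EB : ℝ → Functional C C.BgB := fun b _ _ _ => a * b
    ∀ (b : ℝ) (g : ℕ → ℝ) (U : C.BgB) (X : C.Dom), EB b g U X = EA (prependCoupling b g) (id U) (X + 1) := by
  intro C EA EB b g U X
  show a * b = a * prependCoupling b g 0
  rw [prependCoupling_zero]

/-- **NE9 HOLDS with the CONSTANT first-entry modulus `|a|`** (moduli `Λ n i = |a|·[i = 0]`, decay rate `κ` arbitrary since the tree length is `0`). [folklore] -/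
theorem toy_ne9_firstEntryModulus (a γ κ : ℝ) :
    let C : Carriers := ⟨ℕ, fun X => X + 1, fun _ => 0, fun _ => le_rfl, PUnit, PUnit, fun _ _ => 0, fun _ _ => le_rfl, id⟩
    let EA : Functional C C.BgA := fun s _ _ => a * s 0
    NE9 EA (Window γ) κ (fun _ i => if i = 0 then |a| else 0) := by
  intro C EA g _ g' _ U X
  show |a * g 0 - a * g' 0| ≤ Real.exp (-(κ * 0)) * ∑ i ∈ Finset.range (X + 1), (if i = 0 then |a| else 0) * |g i - g' i|
  rw [mul_zero, neg_zero, Real.exp_zero, one_mul, Finset.sum_range_succ']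
  have hz : ∑ i ∈ Finset.range X, (if i + 1 = 0 then |a| else 0) * |g (i + 1) - g' (i + 1)| = 0 :=
    Finset.sum_eq_zero fun i _ => by simp
  rw [hz, zero_add, if_pos rfl, ← mul_sub, abs_mul]

/-- **… AND THAT MODULUS DOES NOT FADE**: for `a ≠ 0` there are no `C₉` and `ω ∈ [0,1[` with `|a| ≤ C₉ω^n` for all `n ≥ 1` (the bound tends to `0`). [folklore] -/
theorem toy_firstEntryModulus_not_fading {a : ℝ} (ha : a ≠ 0) :
    ¬ ∃ C₉ ω : ℝ, 0 ≤ ω ∧ ω < 1 ∧ ∀ n : ℕ, 1 ≤ n → (fun (_ : ℕ) (i : ℕ) => if i = 0 then |a| else (0 : ℝ)) n 0 ≤ C₉ * ω ^ n := by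
  rintro ⟨C₉, ω, hω0, hω1, h⟩
  have hlim : Filter.Tendsto (fun n : ℕ => C₉ * ω ^ n) Filter.atTop (nhds 0) := by
    simpa using (tendsto_pow_atTop_nhds_zero_of_lt_one hω0 hω1).const_mul C₉
  have hpos : 0 < |a| := abs_pos.mpr ha
  obtain ⟨n, hn⟩ := ((hlim.eventually (gt_mem_nhds hpos)).and (Filter.eventually_ge_atTop 1)).exists
  have h' : |a| ≤ C₉ * ω ^ n := by simpa using h n hn.2
  exact absurd h' (not_le.mpr hn.1)

/-- **THE STEP-MATCHED LETTER HOLDS EXACTLY** (law `β ≡ 0`: matched pairs have `1∕b² = 1∕(s 0)²`, hence `b = s 0`; constant `0`, any `θ`, `κ`). [folklore] -/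
theorem toy_stepMatched_zero (a γ κ θ : ℝ) :
    let C : Carriers := ⟨ℕ, fun X => X + 1, fun _ => 0, fun _ => le_rfl, PUnit, PUnit, fun _ _ => 0, fun _ _ => le_rfl, id⟩
    let EA : Functional C C.BgA := fun s _ _ => a * s 0
    let EB : ℝ → Functional C C.BgB := fun b _ _ _ => a * b
    ∀ b, 0 < b → b ≤ γ → ∀ s ∈ Window γ, 1 / b ^ 2 = 1 / (s 0) ^ 2 + (fun _ _ => 0 : HBeta) 0 (fun _ => b) →
      ∀ (U : C.BgB) (X : C.Dom), |EA s (C.transport U) X - EB b s U X| ≤ 0 * θ ^ C.scale X * Real.exp (-(κ * C.d X)) := by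
  intro C EA EB b hb _ s hs hm U X
  have hs0 : 0 < s 0 := (mem_window.mp hs 0).1
  have hm' : 1 / b ^ 2 = 1 / (s 0) ^ 2 := by simpa using hm
  have hbs : b = s 0 := by
    have h2 : b ^ 2 = (s 0) ^ 2 := by
      have := congrArg (fun x : ℝ => 1 / x) hm'
      simpa [one_div_one_div] using this
    exact (pow_left_inj₀ hb.le hs0.le two_ne_zero).mp h2
  have h : EA s (C.transport U) X - EB b s U X = 0 := by
    show a * s 0 - a * b = 0
    rw [hbs, sub_self]
  rw [h, abs_zero, zero_mul, zero_mul]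

/-- **… WHILE THE BOX LETTER FAILS** for every `C₅` and every `0 ≤ θ < 1` once `a ≠ 0`, `γ > 0`: at the unmatched pair `b = γ∕2`, `s ≡ γ` the difference is `|a|γ∕2` at every level, and
`C₅θ^{X+1} → 0`.  With `toy_link` + `toy_ne9_firstEntryModulus` + `toy_stepMatched_zero` this shows FILE 1's fading hypothesis on the first-entry modulus cannot be dropped.
[folklore] -/
theorem toy_not_boxLetter {a γ θ : ℝ} (ha : a ≠ 0) (hγ : 0 < γ) (hθ0 : 0 ≤ θ) (hθ1 : θ < 1) (κ C₅ : ℝ) :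
    let C : Carriers := ⟨ℕ, fun X => X + 1, fun _ => 0, fun _ => le_rfl, PUnit, PUnit, fun _ _ => 0, fun _ _ => le_rfl, id⟩
    let EA : Functional C C.BgA := fun s _ _ => a * s 0
    let EB : ℝ → Functional C C.BgB := fun b _ _ _ => a * b
    ¬ ∀ b, 0 < b → b ≤ γ → NE5 EA (EB b) (Window γ) κ θ C₅ := by
  intro C EA EB h
  have hs : (fun _ : ℕ => γ) ∈ Window γ := mem_window.mpr fun _ => ⟨hγ, le_rfl⟩
  have key : ∀ X : ℕ, |a| * (γ / 2) ≤ C₅ * θ ^ (X + 1) := by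
    intro X
    have hX := h (γ / 2) (by linarith) (by linarith) (fun _ => γ) hs PUnit.unit X
    have e : EA (fun _ => γ) (C.transport PUnit.unit) X - EB (γ / 2) (fun _ => γ) PUnit.unit X = a * (γ / 2) := by
      show a * γ - a * (γ / 2) = a * (γ / 2)
      ring
    have hd : Real.exp (-(κ * C.d X)) = 1 := by show Real.exp (-(κ * 0)) = 1; simp
    rw [e, hd, mul_one, abs_mul, abs_of_pos (by linarith : (0 : ℝ) < γ / 2)] at hX
    exact hX
  have hlim : Filter.Tendsto (fun X : ℕ => C₅ * θ ^ (X + 1)) Filter.atTop (nhds 0) := by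
    have h1 := (tendsto_pow_atTop_nhds_zero_of_lt_one hθ0 hθ1).const_mul C₅
    rw [mul_zero] at h1
    exact h1.comp (Filter.tendsto_add_atTop_nat 1)
  have hpos : 0 < |a| * (γ / 2) := mul_pos (abs_pos.mpr ha) (by linarith)
  obtain ⟨X, hX⟩ := (hlim.eventually (gt_mem_nhds hpos)).exists
  exact absurd (key X) (not_le.mpr hX)

end Toy


end YMDAG.N18.KeyingsModuloN22

end
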